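import Summits.AtomisticToContinuum.Crystallization.Theorems.StackingFaultSparsity.Negative.HcpTwin

/-!
# `StackingFaultSparsity` (stmt-AtomisticToContinuum-14296), negative side IV: symmetric twelve-shells are never hcp windows

Part IV of the refuter's negative-side lemmas (I `HcpTwin`, II `BarlowWindow`, III `DimerGas`,
V `Cuboctahedron`; this part imports only I).  The metric classification behind "fcc-coordinated
sites are counted by the crux":

* `dist_barlowPos_pair_sq`, `norm_add_sub_two_sq` — two- and three-point identities in the integer
  coordinates `X = 2Δi + Δj + ΔL`, `Y = 3Δj + ΔL` (lateral part `a²(3X² + Y²)/12`).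
* `hcp_odd_layer_far` — ODD LAYERS ARE EXCLUDED BY CENTROSYMMETRY: in `hcpStacking a h`
  (`a, h > 1/2`), if `p` lies an odd number of layers from `z` then `‖p + p' − 2z‖ > 1/50` for every
  stacking point `p'` (the inverted point `2z − p` sits over a `C` hole of a `B` layer, lateral defect
  `≥ a/√3`).
* `hcp_even_census` — EVEN LAYERS near distance `1` (`a ≥ 99/100`): only the six in-layer neighbours
  and the two axial second-layer sites (`D8`, eight candidates; `loeschian_eq_one`).
* `not_hcpMatched_of_symmetric_shell` — a site carrying twelve pairwise `≥ 1`-separated particles at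
  distance exactly `1`, closed under inversion through the site, with nothing else strictly inside, is
  `(1, 1/100)`-matched to NO `hcpStacking a h`, `a, h ∈ (1/2, 2)`: twelve distinct model points would
  have to fit into eight candidates.
-/

noncomputable section

namespace Summit.AtomisticToContinuum.Crystallization.Theorems.StackingFaultSparsityNegative

open Literature.MathematicalPhysics.StatisticalMechanics

/-- Parity lemma: integers `X ≡ Y (mod 2)`, not both zero, have `3X² + Y² ≥ 4` (private copy of the
lemma of part II, to keep this file independent of it). [folklore] -/
private theorem parity_four_le_aux {X Y : ℤ} (hpar : Even (X - Y)) (hne : (X, Y) ≠ 0) :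
    4 ≤ 3 * X ^ 2 + Y ^ 2 := by
  rcases Int.even_or_odd Y with ⟨t, rfl⟩ | ⟨t, rfl⟩
  · have hX : Even X := by
      have : X = (X - (t + t)) + (t + t) := by ring
      rw [this]; exact hpar.add ⟨t, rfl⟩
    obtain ⟨u, rfl⟩ := hX
    by_cases ht : t = 0
    · subst ht
      have hu : u ≠ 0 := by rintro rfl; exact hne (by simp)
      have : 0 < u ^ 2 := by positivity
      nlinarith
    · have : 0 < t ^ 2 := by positivity
      nlinarith
  · have hX : Odd X := by
      have : X = (X - (2 * t + 1)) + (2 * t + 1) := by ring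
      rw [this]; exact hpar.add_odd ⟨t, rfl⟩
    obtain ⟨u, rfl⟩ := hX
    have hu : 0 ≤ u * (u + 1) := by
      rcases le_or_gt 0 u with h0 | h0
      · positivity
      · have h1 : u + 1 ≤ 0 := by omega
        exact mul_nonneg_of_nonpos_of_nonpos h0.le h1
    have ht : 0 ≤ t * (t + 1) := by
      rcases le_or_gt 0 t with h0 | h0
      · positivity
      · have h1 : t + 1 ≤ 0 := by omega
        exact mul_nonneg_of_nonpos_of_nonpos h0.le h1
    have key : 3 * (2 * u + 1) ^ 2 + (2 * t + 1) ^ 2 =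
        12 * (u * (u + 1)) + 4 * (t * (t + 1)) + 4 := by ring
    rw [key]
    linarith

/-- Two-point squared distance in integer coordinates `X = 2Δi + Δj + ΔL`, `Y = 3Δj + ΔL`. -/
theorem dist_barlowPos_pair_sq (a h : ℝ) (s : ℤ → ℤ) (k i j k' i' j' : ℤ) :
    dist (barlowPos a h s k i j) (barlowPos a h s k' i' j') ^ 2 =
      a ^ 2 * (3 * (2 * (i - i') + (j - j') + (haggLabel s k - haggLabel s k')) ^ 2 +
        (3 * (j - j') + (haggLabel s k - haggLabel s k')) ^ 2 : ℤ) / 12 + ((k - k') * h) ^ 2 := by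
  rw [dist_barlowPos_sq]
  have h3 : (√3 : ℝ) ^ 2 = 3 := Real.sq_sqrt (by norm_num)
  push_cast
  linear_combination (a ^ 2 * (3 * (j - j') + (haggLabel s k - haggLabel s k')) ^ 2 / 36) * h3

/-- Squared norm of `p + p' - 2 z` for three stacking points, in integer coordinates
`X = 2(i + i' - 2i₀) + (j + j' - 2j₀) + Λ`, `Y = 3(j + j' - 2j₀) + Λ`, `Λ = L k + L k' - 2 L k₀`. -/
theorem norm_add_sub_two_sq (a h : ℝ) (s : ℤ → ℤ) (k i j k' i' j' k₀ i₀ j₀ : ℤ) :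
    ‖barlowPos a h s k i j + barlowPos a h s k' i' j' - (2 : ℝ) • barlowPos a h s k₀ i₀ j₀‖ ^ 2 =
      a ^ 2 * (3 * (2 * (i + i' - 2 * i₀) + (j + j' - 2 * j₀) +
          (haggLabel s k + haggLabel s k' - 2 * haggLabel s k₀)) ^ 2 +
        (3 * (j + j' - 2 * j₀) + (haggLabel s k + haggLabel s k' - 2 * haggLabel s k₀)) ^ 2 : ℤ) / 12 +
      ((k + k' - 2 * k₀) * h) ^ 2 := by
  rw [EuclideanSpace.norm_eq, Real.sq_sqrt (Finset.sum_nonneg fun _ _ => sq_nonneg _),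
    Fin.sum_univ_three]
  have h3 : (√3 : ℝ) ^ 2 = 3 := Real.sq_sqrt (by norm_num)
  simp only [PiLp.sub_apply, PiLp.add_apply, PiLp.smul_apply, smul_eq_mul, barlowPos_apply_zero,
    barlowPos_apply_one, barlowPos_apply_two, Real.norm_eq_abs, sq_abs]
  push_cast
  linear_combination (a ^ 2 * (3 * (j + j' - 2 * j₀) +
    (haggLabel s k + haggLabel s k' - 2 * haggLabel s k₀)) ^ 2 / 36) * h3

/-- **Odd layers are excluded by centrosymmetry.** In `hcpStacking a h` (`a, h > 1/2`), if `p` lies an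
odd number of layers away from `z`, then `p + p' - 2z` has norm `> 1/50` for every stacking point `p'`:
the inverted point `2z - p` is far from the stacking (its layer carries the letter `C` where the
stacking has `B`). -/
theorem hcp_odd_layer_far {a h : ℝ} (ha : 1 / 2 < a) (hh : 1 / 2 < h) {k i j k' i' j' k₀ i₀ j₀ : ℤ}
    (hodd : Odd (k - k₀))
    (hsmall : ‖barlowPos a h alternatingHagg k i j + barlowPos a h alternatingHagg k' i' j' -
      (2 : ℝ) • barlowPos a h alternatingHagg k₀ i₀ j₀‖ ≤ 1 / 50) : False := by
  set v := barlowPos a h alternatingHagg k i j + barlowPos a h alternatingHagg k' i' j' -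
      (2 : ℝ) • barlowPos a h alternatingHagg k₀ i₀ j₀ with hv
  -- vertical component: k + k' = 2 k₀
  have hvert : k + k' - 2 * k₀ = 0 := by
    by_contra hne
    have h2 : |v 2| ≤ ‖v‖ := by
      have := PiLp.norm_apply_le v 2
      rwa [Real.norm_eq_abs] at this
    have hv2 : v 2 = ((k : ℝ) + k' - 2 * k₀) * h := by
      simp only [hv, PiLp.sub_apply, PiLp.add_apply, PiLp.smul_apply, smul_eq_mul,
        barlowPos_apply_two]
      ring
    rw [hv2, abs_mul, abs_of_pos (by linarith : (0 : ℝ) < h)] at h2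
    have h1 : (1 : ℝ) ≤ |((k : ℝ) + k' - 2 * k₀)| := by
      rw [show ((k : ℝ) + k' - 2 * k₀) = ((k + k' - 2 * k₀ : ℤ) : ℝ) by push_cast; ring,
        ← Int.cast_abs]
      exact_mod_cast Int.one_le_abs hne
    nlinarith
  -- labels: L k = L k' ≠ L k₀, so Λ = ±2
  have hk' : k' = 2 * k₀ - k := by omega
  have hko : ¬ (Even k ↔ Even k₀) := fun h0 =>
    (Int.not_even_iff_odd.mpr hodd) (Int.even_sub.mpr h0)
  have hkk : (Even k' ↔ Even k) := by rw [hk', Int.even_sub]; simp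
  set Λ := haggLabel alternatingHagg k + haggLabel alternatingHagg k' -
      2 * haggLabel alternatingHagg k₀ with hΛdef
  have hΛ : Λ = 2 ∨ Λ = -2 := by
    rw [hΛdef, haggLabel_alternating, haggLabel_alternating, haggLabel_alternating]
    by_cases hk : Even k
    · have h0 : ¬ Even k₀ := fun h0 => hko (iff_of_true hk h0)
      have hk'' : Even k' := hkk.mpr hk
      simp [hk, h0, hk'']
    · have h0 : Even k₀ := by
        by_contra h0; exact hko (iff_of_false hk h0)
      have hk'' : ¬ Even k' := fun h' => hk (hkk.mp h')
      simp [hk, h0, hk'']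
  -- the integer form
  have hsq := norm_add_sub_two_sq a h alternatingHagg k i j k' i' j' k₀ i₀ j₀
  rw [← hΛdef] at hsq
  set X : ℤ := 2 * (i + i' - 2 * i₀) + (j + j' - 2 * j₀) + Λ with hX
  set Y : ℤ := 3 * (j + j' - 2 * j₀) + Λ with hY
  have hY0 : Y ≠ 0 := by rcases hΛ with h0 | h0 <;> omega
  have hXY : ((X, Y) : ℤ × ℤ) ≠ 0 := by
    intro h0; rw [Prod.mk_eq_zero] at h0; exact hY0 h0.2
  have h4 : 4 ≤ 3 * X ^ 2 + Y ^ 2 := parity_four_le_aux ⟨(i + i' - 2 * i₀) - (j + j' - 2 * j₀), by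
    rw [hX, hY]; ring⟩ hXY
  have h4' : (4 : ℝ) ≤ ((3 * X ^ 2 + Y ^ 2 : ℤ) : ℝ) := by exact_mod_cast h4
  have hvert' : ((k : ℝ) + k' - 2 * k₀) = 0 := by exact_mod_cast hvert
  rw [hvert', zero_mul, zero_pow two_ne_zero, add_zero] at hsq
  -- ‖v‖² ≥ a²/3 > 1/12, but ‖v‖ ≤ 1/50
  have hv2 : ‖v‖ ^ 2 ≤ (1 / 50) ^ 2 := by gcongr
  rw [hsq] at hv2
  nlinarith

/-- The integer solutions of `m² + mn + n² = 1` (the six unit vectors of the triangular lattice). -/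
theorem loeschian_eq_one {m n : ℤ} (h : m ^ 2 + m * n + n ^ 2 = 1) :
    (m = 1 ∧ n = 0) ∨ (m = 0 ∧ n = 1) ∨ (m = -1 ∧ n = 0) ∨ (m = 0 ∧ n = -1) ∨
      (m = 1 ∧ n = -1) ∨ (m = -1 ∧ n = 1) := by
  have h3n : 3 * n ^ 2 ≤ 4 := by nlinarith [sq_nonneg (2 * m + n)]
  have h3m : 3 * m ^ 2 ≤ 4 := by nlinarith [sq_nonneg (2 * n + m)]
  have hn : n ^ 2 ≤ 1 := by
    have : n ^ 2 < 2 := by linarith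
    have := Int.lt_iff_add_one_le.mp this; linarith
  have hm : m ^ 2 ≤ 1 := by
    have : m ^ 2 < 2 := by linarith
    have := Int.lt_iff_add_one_le.mp this; linarith
  have hn' := abs_le.mp ((sq_le_one_iff_abs_le_one n).mp hn)
  have hm' := abs_le.mp ((sq_le_one_iff_abs_le_one m).mp hm)
  obtain ⟨hm1, hm2⟩ := hm'
  obtain ⟨hn1, hn2⟩ := hn'
  have h' : m * m + m * n + n * n = 1 := by linear_combination h
  clear h h3n h3m hn hm
  interval_cases m <;> interval_cases n <;> omega

/-- The eight even-layer candidates for hcp points at distance `≈ 1` from a site: the six in-layer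
neighbours and the two sites straight above/below two layers away. -/
def D8 : Finset (ℤ × ℤ × ℤ) :=
  {(0, 1, 0), (0, 0, 1), (0, -1, 0), (0, 0, -1), (0, 1, -1), (0, -1, 1), (2, 0, 0), (-2, 0, 0)}

/-- `D8` has eight elements. [folklore] -/
theorem card_D8 : D8.card = 8 := by decide

/-- **Even-layer census.** In `hcpStacking a h` with `a ≥ 99/100`, `h > 1/2`, a point an even number
of layers away from `z` at distance in `[99/100, 101/100]` is one of the eight candidates `D8`. -/
theorem hcp_even_census {a h : ℝ} (ha : 99 / 100 ≤ a) (hh : 1 / 2 < h) {k i j k₀ i₀ j₀ : ℤ}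
    (heven : Even (k - k₀))
    (hlo : 99 / 100 ≤ dist (barlowPos a h alternatingHagg k i j) (barlowPos a h alternatingHagg k₀ i₀ j₀))
    (hhi : dist (barlowPos a h alternatingHagg k i j) (barlowPos a h alternatingHagg k₀ i₀ j₀) ≤ 101 / 100) :
    (k - k₀, i - i₀, j - j₀) ∈ D8 := by
  have hL : haggLabel alternatingHagg k = haggLabel alternatingHagg k₀ := by
    rw [haggLabel_alternating, haggLabel_alternating]
    have : Even k ↔ Even k₀ := Int.even_sub.mp heven
    simp only [this]
  have hsq := dist_barlowPos_pair_sq a h alternatingHagg k i j k₀ i₀ j₀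
  rw [hL, sub_self] at hsq
  set q : ℤ := (i - i₀) ^ 2 + (i - i₀) * (j - j₀) + (j - j₀) ^ 2 with hq
  have hform : (3 * (2 * (i - i₀) + (j - j₀) + 0) ^ 2 + (3 * (j - j₀) + 0) ^ 2 : ℤ) = 12 * q := by
    rw [hq]; ring
  rw [hform] at hsq
  push_cast at hsq
  set d := dist (barlowPos a h alternatingHagg k i j) (barlowPos a h alternatingHagg k₀ i₀ j₀) with hd
  have hd2lo : (99 / 100) ^ 2 ≤ d ^ 2 := by gcongr
  have hd2hi : d ^ 2 ≤ (101 / 100) ^ 2 := by gcongr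
  have hqnn : (0 : ℤ) ≤ q := by
    have := one_le_sq_add_mul_add_sq (p := i - i₀) (q := j - j₀)
    by_cases h0 : ((i - i₀, j - j₀) : ℤ × ℤ) = 0
    · rw [Prod.mk_eq_zero] at h0; rw [hq, h0.1, h0.2]; norm_num
    · linarith [this h0]
  have hqnn' : (0 : ℝ) ≤ (q : ℝ) := by exact_mod_cast hqnn
  have ha2 : (9801 / 10000 : ℝ) ≤ a ^ 2 := by nlinarith
  have hh2 : (1 / 4 : ℝ) < h ^ 2 := by nlinarith
  -- |k - k₀| ≤ 2
  have hk : (k - k₀) ^ 2 ≤ 4 := by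
    by_contra hk
    have hk5 : (5 : ℤ) ≤ (k - k₀) ^ 2 := by
      push Not at hk; have : 4 < (k - k₀) ^ 2 := hk; omega
    have : (5 : ℝ) ≤ ((k : ℝ) - k₀) ^ 2 := by exact_mod_cast hk5
    nlinarith
  have hk' : -2 ≤ k - k₀ ∧ k - k₀ ≤ 2 := by constructor <;> nlinarith
  have hcases : k - k₀ = 0 ∨ k - k₀ = 2 ∨ k - k₀ = -2 := by
    rcases heven with ⟨m, hm⟩
    omega
  rcases hcases with h0 | h0 | h0
  · -- same layer: a² q ∈ [0.98, 1.02] ⇒ q = 1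
    have h0' : (k : ℝ) - k₀ = 0 := by exact_mod_cast h0
    rw [h0', zero_mul, zero_pow two_ne_zero, add_zero] at hsq
    have hq1 : q ≤ 1 := by
      by_contra hq2
      have : (2 : ℤ) ≤ q := by omega
      have : (2 : ℝ) ≤ (q : ℝ) := by exact_mod_cast this
      nlinarith
    have hq1' : 1 ≤ q := by
      by_contra hq0
      have : q ≤ 0 := by omega
      have : (q : ℝ) ≤ 0 := by exact_mod_cast this
      nlinarith
    have hq_eq : (i - i₀) ^ 2 + (i - i₀) * (j - j₀) + (j - j₀) ^ 2 = 1 := by rw [← hq]; omega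
    rw [h0]
    rcases loeschian_eq_one hq_eq with ⟨h1, h2⟩ | ⟨h1, h2⟩ | ⟨h1, h2⟩ | ⟨h1, h2⟩ | ⟨h1, h2⟩ | ⟨h1, h2⟩ <;>
      rw [h1, h2] <;> decide
  · -- two layers up: q = 0
    have h0' : (k : ℝ) - k₀ = 2 := by exact_mod_cast h0
    rw [h0'] at hsq
    have hq0 : q ≤ 0 := by
      by_contra hq1
      have : (1 : ℤ) ≤ q := by omega
      have : (1 : ℝ) ≤ (q : ℝ) := by exact_mod_cast this
      nlinarith
    have hij : ((i - i₀, j - j₀) : ℤ × ℤ) = 0 := by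
      by_contra hne
      have := one_le_sq_add_mul_add_sq hne
      omega
    rw [Prod.mk_eq_zero] at hij
    rw [h0, hij.1, hij.2]; decide
  · have h0' : (k : ℝ) - k₀ = -2 := by exact_mod_cast h0
    rw [h0'] at hsq
    have hq0 : q ≤ 0 := by
      by_contra hq1
      have : (1 : ℤ) ≤ q := by omega
      have : (1 : ℝ) ≤ (q : ℝ) := by exact_mod_cast this
      nlinarith
    have hij : ((i - i₀, j - j₀) : ℤ × ℤ) = 0 := by
      by_contra hne
      have := one_le_sq_add_mul_add_sq hne
      omega
    rw [Prod.mk_eq_zero] at hij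
    rw [h0, hij.1, hij.2]; decide

/-- **A centrosymmetric twelve-shell at distance `1` is never an hcp window** (`R = 1`, `ε = 1/100`):
if twelve pairwise `≥ 1`-separated particles sit at distance exactly `1` from `X i`, closed under
`v ↦ -v`, and no other particle is strictly within distance `1`, then `i` is matched to no relaxed
hcp.  Centrosymmetry excludes model points in odd layers (`hcp_odd_layer_far`), and the even layers
offer only eight candidates (`hcp_even_census`) for twelve distinct model points. -/
theorem not_hcpMatched_of_symmetric_shell {N : ℕ} (X : Fin N → E3) (i : Fin N) (S : Finset (Fin N))
    (hS : S.card = 12) (hS1 : ∀ j ∈ S, dist (X j) (X i) = 1)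
    (hSsep : ∀ j ∈ S, ∀ j' ∈ S, j ≠ j' → 1 ≤ dist (X j) (X j'))
    (hSsymm : ∀ j ∈ S, ∃ j' ∈ S, X j' - X i = -(X j - X i))
    (hgap : ∀ j : Fin N, dist (X j) (X i) < 1 → X j = X i) :
    ¬ HcpMatched 1 (1 / 100) X i := by
  rintro ⟨a, h, ha1, -, hh1, -, z, ⟨k₀, i₀, j₀, rfl⟩, A, h1, h2⟩
  -- Step A: a ≥ 99/100 (the in-layer neighbour of the centre must carry a particle or be far)
  have ha99 : 99 / 100 ≤ a := by
    by_contra hlt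
    push Not at hlt
    have hd : dist (barlowPos a h alternatingHagg k₀ (i₀ + 1) j₀)
        (barlowPos a h alternatingHagg k₀ i₀ j₀) = a := by
      have h2' : dist (barlowPos a h alternatingHagg k₀ (i₀ + 1) j₀)
          (barlowPos a h alternatingHagg k₀ i₀ j₀) ^ 2 = a ^ 2 := by
        rw [dist_barlowPos_pair_sq]; push_cast; ring
      rw [← Real.sqrt_sq dist_nonneg, h2', Real.sqrt_sq (by linarith)]
    obtain ⟨j, hj⟩ := h1 _ (barlowPos_mem _ _ _) (by rw [hd]; linarith)
    have hn : ‖A (barlowPos a h alternatingHagg k₀ (i₀ + 1) j₀ - barlowPos a h alternatingHagg k₀ i₀ j₀)‖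
        = a := by rw [LinearIsometry.norm_map, ← dist_eq_norm, hd]
    have hji : dist (X j) (X i) < 1 := by
      have := dist_triangle (X j) (X i + A (barlowPos a h alternatingHagg k₀ (i₀ + 1) j₀ -
        barlowPos a h alternatingHagg k₀ i₀ j₀)) (X i)
      rw [dist_eq_norm (X i + _) (X i), add_sub_cancel_left, hn] at this
      linarith
    have hjj := hgap j hji
    rw [hjj, dist_eq_norm, sub_add_cancel_left, norm_neg, hn] at hj
    linarith
  -- Step B: model points of the twelve shell particles
  have hP : ∀ j ∈ S, ∃ p ∈ hcpStacking a h,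
      dist (X j) (X i + A (p - barlowPos a h alternatingHagg k₀ i₀ j₀)) ≤ 1 / 100 :=
    fun j hj => h2 j (by rw [hS1 j hj])
  choose! P hPmem hPd using hP
  have hPrep : ∀ j ∈ S, ∃ t : ℤ × ℤ × ℤ, P j = barlowPos a h alternatingHagg t.1 t.2.1 t.2.2 :=
    fun j hj => by obtain ⟨k, i', j', h0⟩ := hPmem j hj; exact ⟨(k, i', j'), h0⟩
  choose! T hT using hPrep
  set z := barlowPos a h alternatingHagg k₀ i₀ j₀ with hz
  have hnormP : ∀ j ∈ S, ‖A (P j - z)‖ = dist (P j) z := fun j _ => by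
    rw [LinearIsometry.norm_map, dist_eq_norm]
  have hPz : ∀ j ∈ S, 99 / 100 ≤ dist (P j) z ∧ dist (P j) z ≤ 101 / 100 := by
    intro j hj
    have e1 := hPd j hj
    have e2 := hS1 j hj
    have t1 := dist_triangle (X j) (X i + A (P j - z)) (X i)
    have t2 := dist_triangle (X i + A (P j - z)) (X j) (X i)
    rw [dist_eq_norm (X i + _) (X i), add_sub_cancel_left, hnormP j hj] at t1 t2
    rw [dist_comm (X i + A (P j - z)) (X j)] at t2
    constructor <;> linarith
  -- parity: odd layers are excluded by the centrosymmetry of the shell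
  have hEven : ∀ j ∈ S, Even ((T j).1 - k₀) := by
    intro j hj
    by_contra hodd
    rw [Int.not_even_iff_odd] at hodd
    obtain ⟨j', hj', hsymm⟩ := hSsymm j hj
    refine hcp_odd_layer_far ha1 hh1 hodd (i := (T j).2.1) (j := (T j).2.2) (k' := (T j').1)
      (i' := (T j').2.1) (j' := (T j').2.2) (i₀ := i₀) (j₀ := j₀) ?_
    rw [← hT j hj, ← hT j' hj', ← hz]
    have hsum : P j + P j' - (2 : ℝ) • z = (P j - z) + (P j' - z) := by rw [two_smul]; abel
    have h0 : (X i - X j) + (X i - X j') = 0 := by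
      have : X i - X j' = -(X j' - X i) := by abel
      rw [this, hsymm]; abel
    have key : A (P j - z) + A (P j' - z) =
        (X i + A (P j - z) - X j) + (X i + A (P j' - z) - X j') := by
      have : (X i + A (P j - z) - X j) + (X i + A (P j' - z) - X j') =
          (A (P j - z) + A (P j' - z)) + ((X i - X j) + (X i - X j')) := by abel
      rw [this, h0, add_zero]
    rw [← A.norm_map, hsum, map_add, key]
    refine (norm_add_le _ _).trans ?_
    rw [← dist_eq_norm, ← dist_eq_norm, dist_comm]
    have e1 := hPd j hj
    have e2 := hPd j' hj'
    rw [dist_comm] at e2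
    linarith
  -- census: every model point is one of eight candidates
  have hΦ : ∀ j ∈ S, ((T j).1 - k₀, (T j).2.1 - i₀, (T j).2.2 - j₀) ∈ D8 := by
    intro j hj
    have hlo := (hPz j hj).1
    have hhi := (hPz j hj).2
    rw [hT j hj] at hlo hhi
    exact hcp_even_census ha99 hh1 (hEven j hj) hlo hhi
  -- injectivity: distinct shell particles have distinct model points
  have hinj : Set.InjOn (fun j => ((T j).1 - k₀, (T j).2.1 - i₀, (T j).2.2 - j₀)) S := by
    intro j hj j' hj' heq
    simp only [Prod.mk.injEq] at heq
    have hTT : T j = T j' := Prod.ext (by omega) (Prod.ext (by omega) (by omega))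
    have hPP : P j = P j' := by rw [hT j hj, hT j' hj', hTT]
    by_contra hne
    have h1le := hSsep j hj j' hj' hne
    have t := dist_triangle (X j) (X i + A (P j - z)) (X j')
    have e1 := hPd j hj
    have e2 := hPd j' hj'
    rw [← hPP, dist_comm] at e2
    linarith
  have hcard := Finset.card_le_card_of_injOn _ hΦ hinj
  rw [hS, card_D8] at hcard
  omega

end Summit.AtomisticToContinuum.Crystallization.Theorems.StackingFaultSparsityNegative

end
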